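import Mathlib
import HarnessLib
import Summits.Ventures.LatticeQCDFlow.Exactness.SU2LuscherDeterminant
import Summits.Ventures.LatticeQCDFlow.Exactness.SU2WilsonFlowLOSchedule

/-!
# The engine's `SU(2)` LO Wilson-flow sub-step is CONTINUOUS: the masked sub-step map and its booked density (a `sinc` closed form — Lüscher's determinant without case split)

HONEST FRAMING: exact (Metropolis-corrected) sampling algorithms for lattice gauge theory;
figures of merit are autocorrelation/cost numbers at stated couplings and volumes; no
continuum-physics claim.

Venture `LatticeQCDFlow` (cell pub-lqcd), topic `Exactness`; FANOUT row 14 (`eng-flowhmc`; member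
`maps.wilson_flow_lo`).  NEW WORK of the cell; nothing is cited as a fact; no number.  The typed
members were certified MEASURABLE (enough for exactness); the exact-force covariance theorem
`SU2ExactForceCovariance.su2_fthmc_exactForce_conjKernel_gaugeTransform` asks for a CONTINUOUS
pulled-back action `S̃ = S∘F − log J` (measurability of the Fréchet derivative with a parameter).
This file discharges that for the LO member:

* `luscherIf_eq_sinc` — Lüscher's closed-form determinant `(1 − c j₀)(cos(c|j⃗|) − j₀ sin(c|j⃗|)/|j⃗|)²`
  (with its `|j⃗| = 0` branch `(1 − c j₀)³`, `SU2LuscherDeterminant`) IS the single expression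
  `(1 − c j₀)(cos(c|j⃗|) − c j₀ sinc(c|j⃗|))²` — no case split; `continuous_luscherSinc`;
* **`continuous_su2WilsonFlowLOFactor`** — the booked per-link density (the `if sin θ = 0 then
  (1 − ε|J|cos θ)³ else kickJac (ε|J|) 2 θ` of the certified sub-step) is a continuous function of
  the field (`luscherDet_closedForm_eq_booked` + the sinc form + continuity of `V ↦ V_e⁻¹ ⋆ J_e(V)`);
  **`continuous_su2WilsonFlowLOJacobian`** (the layer density), **`continuous_su2WilsonFlowLOSubstepFun`**
  (the masked sub-step map: row 7's `continuous_geodesicKick₂`, `gaussUnit` continuous off `0`, the kick has unit norm);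
* the member level (lists of layers, `S̃` continuous) is the sequel
  `SU2WilsonFlowLOMemberContinuity.lean`.

NOT CLAIMED: differentiability (the engine differentiates `S̃`; only continuity is typed here);
`SU(N ≥ 3)`; any number.
-/

noncomputable section

namespace Summit.Ventures.LatticeQCDFlow.Exactness

open Real WithLp Set MeasureTheory InnerProductGeometry
open Literature.MathematicalPhysics.QuantumFieldTheory
open scoped Matrix InnerProductSpace

/-! ## Lüscher's closed-form determinant is a `sinc` expression; continuity -/

section Luscher

/-- `Σ vᵢ² ≥ 0`. -/
theorem dotProduct_self_nonneg_fin3 (v : Fin 3 → ℝ) : 0 ≤ dotProduct v v := by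
  unfold dotProduct
  exact Finset.sum_nonneg fun i _ => mul_self_nonneg (v i)

/-- **No case split**: `(if |j⃗|² = 0 then (1 − c j₀)³ else (1 − c j₀)(cos(c|j⃗|) − j₀ sin(c|j⃗|)/|j⃗|)²)
= (1 − c j₀)(cos(c|j⃗|) − c j₀ sinc(c|j⃗|))²`. -/
theorem luscherIf_eq_sinc (c j₀ : ℝ) (v : Fin 3 → ℝ) :
    (if dotProduct v v = 0 then (1 - c * j₀) ^ 3
      else (1 - c * j₀) * (Real.cos (c * √(dotProduct v v)) -
        j₀ * Real.sin (c * √(dotProduct v v)) / √(dotProduct v v)) ^ 2) =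
      (1 - c * j₀) * (Real.cos (c * √(dotProduct v v)) -
        j₀ * (c * Real.sinc (c * √(dotProduct v v)))) ^ 2 := by
  by_cases hd : dotProduct v v = 0
  · rw [if_pos hd, hd, Real.sqrt_zero, mul_zero, Real.cos_zero, Real.sinc_zero, mul_one]
    ring
  · rw [if_neg hd]
    have hpos : 0 < dotProduct v v := lt_of_le_of_ne (dotProduct_self_nonneg_fin3 v) (Ne.symm hd)
    have hr : √(dotProduct v v) ≠ 0 := Real.sqrt_ne_zero'.mpr hpos
    have key := Literature.Geometry.Riemannian.mul_sinc (c * √(dotProduct v v))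
    have h1 : j₀ * Real.sin (c * √(dotProduct v v)) / √(dotProduct v v) =
        j₀ * (c * Real.sinc (c * √(dotProduct v v))) := by
      rw [div_eq_iff hr]
      linear_combination (-j₀) * key
    rw [h1]

/-- The `sinc` expression is a continuous function of `j ∈ ℝ⁴`. -/
theorem continuous_luscherSinc (c : ℝ) :
    Continuous fun j : R4 => (1 - c * j 0) * (Real.cos (c * √(dotProduct ![j 1, j 2, j 3] ![j 1, j 2, j 3])) -
        j 0 * (c * Real.sinc (c * √(dotProduct ![j 1, j 2, j 3] ![j 1, j 2, j 3])))) ^ 2 := by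
  have hc : ∀ i, Continuous fun j : R4 => j i := fun i => PiLp.continuous_apply 2 _ i
  have hd : Continuous fun j : R4 => dotProduct ![j 1, j 2, j 3] ![j 1, j 2, j 3] := by
    have heq : (fun j : R4 => dotProduct ![j 1, j 2, j 3] ![j 1, j 2, j 3]) =
        fun j : R4 => j 1 * j 1 + j 2 * j 2 + j 3 * j 3 := by
      funext j
      simp [dotProduct, Fin.sum_univ_three]
    rw [heq]
    exact (((hc 1).mul (hc 1)).add ((hc 2).mul (hc 2))).add ((hc 3).mul (hc 3))
  have hr : Continuous fun j : R4 => c * √(dotProduct ![j 1, j 2, j 3] ![j 1, j 2, j 3]) :=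
    continuous_const.mul (Real.continuous_sqrt.comp hd)
  exact (continuous_const.sub (continuous_const.mul (hc 0))).mul
    (((Real.continuous_cos.comp hr).sub ((hc 0).mul (continuous_const.mul
      (Real.continuous_sinc.comp hr)))).pow 2)

end Luscher

/-! ## The booked per-link density and the masked sub-step are continuous in the field -/

section Layer

variable {d L : ℕ}

/-- **The booked per-link density of the LO sub-step is a continuous function of the field** (it
is Lüscher's determinant, `luscherDet_closedForm_eq_booked`, in its case-free `sinc` form, composed
with the continuous `V ↦ V_e⁻¹ ⋆ J_e(V)`). -/
theorem continuous_su2WilsonFlowLOFactor (ε : ℝ) (e : Edge d L) :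
    Continuous fun V : GaugeConfig d L (Matrix.specialUnitaryGroup (Fin 2) ℂ) =>
      (if Real.sin (angle (∑ ν ∈ Finset.univ.erase e.2,
            (vecQuat (((V (Site.shift e.1 e.2, ν) * (V (Site.shift e.1 ν, e.2))⁻¹ * (V (e.1, ν))⁻¹)⁻¹ : (Matrix.specialUnitaryGroup (Fin 2) ℂ)) : Matrix (Fin 2) (Fin 2) ℂ) +
              vecQuat ((((V (Site.shift (e.1 - Pi.single ν 1) e.2, ν))⁻¹ * (V (e.1 - Pi.single ν 1, e.2))⁻¹ *
                V (e.1 - Pi.single ν 1, ν))⁻¹ : (Matrix.specialUnitaryGroup (Fin 2) ℂ)) : Matrix (Fin 2) (Fin 2) ℂ))) (vecQuat ((V e : (Matrix.specialUnitaryGroup (Fin 2) ℂ)) : Matrix (Fin 2) (Fin 2) ℂ))) = 0 then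
            (1 - ε * ‖(∑ ν ∈ Finset.univ.erase e.2,
            (vecQuat (((V (Site.shift e.1 e.2, ν) * (V (Site.shift e.1 ν, e.2))⁻¹ * (V (e.1, ν))⁻¹)⁻¹ : (Matrix.specialUnitaryGroup (Fin 2) ℂ)) : Matrix (Fin 2) (Fin 2) ℂ) +
              vecQuat ((((V (Site.shift (e.1 - Pi.single ν 1) e.2, ν))⁻¹ * (V (e.1 - Pi.single ν 1, e.2))⁻¹ *
                V (e.1 - Pi.single ν 1, ν))⁻¹ : (Matrix.specialUnitaryGroup (Fin 2) ℂ)) : Matrix (Fin 2) (Fin 2) ℂ)))‖ * Real.cos (angle (∑ ν ∈ Finset.univ.erase e.2,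
            (vecQuat (((V (Site.shift e.1 e.2, ν) * (V (Site.shift e.1 ν, e.2))⁻¹ * (V (e.1, ν))⁻¹)⁻¹ : (Matrix.specialUnitaryGroup (Fin 2) ℂ)) : Matrix (Fin 2) (Fin 2) ℂ) +
              vecQuat ((((V (Site.shift (e.1 - Pi.single ν 1) e.2, ν))⁻¹ * (V (e.1 - Pi.single ν 1, e.2))⁻¹ *
                V (e.1 - Pi.single ν 1, ν))⁻¹ : (Matrix.specialUnitaryGroup (Fin 2) ℂ)) : Matrix (Fin 2) (Fin 2) ℂ))) (vecQuat ((V e : (Matrix.specialUnitaryGroup (Fin 2) ℂ)) : Matrix (Fin 2) (Fin 2) ℂ)))) ^ 3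
          else kickJac (ε * ‖(∑ ν ∈ Finset.univ.erase e.2,
            (vecQuat (((V (Site.shift e.1 e.2, ν) * (V (Site.shift e.1 ν, e.2))⁻¹ * (V (e.1, ν))⁻¹)⁻¹ : (Matrix.specialUnitaryGroup (Fin 2) ℂ)) : Matrix (Fin 2) (Fin 2) ℂ) +
              vecQuat ((((V (Site.shift (e.1 - Pi.single ν 1) e.2, ν))⁻¹ * (V (e.1 - Pi.single ν 1, e.2))⁻¹ *
                V (e.1 - Pi.single ν 1, ν))⁻¹ : (Matrix.specialUnitaryGroup (Fin 2) ℂ)) : Matrix (Fin 2) (Fin 2) ℂ)))‖) 2 (angle (∑ ν ∈ Finset.univ.erase e.2,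
            (vecQuat (((V (Site.shift e.1 e.2, ν) * (V (Site.shift e.1 ν, e.2))⁻¹ * (V (e.1, ν))⁻¹)⁻¹ : (Matrix.specialUnitaryGroup (Fin 2) ℂ)) : Matrix (Fin 2) (Fin 2) ℂ) +
              vecQuat ((((V (Site.shift (e.1 - Pi.single ν 1) e.2, ν))⁻¹ * (V (e.1 - Pi.single ν 1, e.2))⁻¹ *
                V (e.1 - Pi.single ν 1, ν))⁻¹ : (Matrix.specialUnitaryGroup (Fin 2) ℂ)) : Matrix (Fin 2) (Fin 2) ℂ))) (vecQuat ((V e : (Matrix.specialUnitaryGroup (Fin 2) ℂ)) : Matrix (Fin 2) (Fin 2) ℂ)))) := by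
  have hl : Continuous fun V : GaugeConfig d L (Matrix.specialUnitaryGroup (Fin 2) ℂ) => lmulIso (V e)⁻¹ (∑ ν ∈ Finset.univ.erase e.2,
            (vecQuat (((V (Site.shift e.1 e.2, ν) * (V (Site.shift e.1 ν, e.2))⁻¹ * (V (e.1, ν))⁻¹)⁻¹ : (Matrix.specialUnitaryGroup (Fin 2) ℂ)) : Matrix (Fin 2) (Fin 2) ℂ) +
              vecQuat ((((V (Site.shift (e.1 - Pi.single ν 1) e.2, ν))⁻¹ * (V (e.1 - Pi.single ν 1, e.2))⁻¹ *
                V (e.1 - Pi.single ν 1, ν))⁻¹ : (Matrix.specialUnitaryGroup (Fin 2) ℂ)) : Matrix (Fin 2) (Fin 2) ℂ))) := by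
    have heq : (fun V : GaugeConfig d L (Matrix.specialUnitaryGroup (Fin 2) ℂ) => lmulIso (V e)⁻¹ (∑ ν ∈ Finset.univ.erase e.2,
            (vecQuat (((V (Site.shift e.1 e.2, ν) * (V (Site.shift e.1 ν, e.2))⁻¹ * (V (e.1, ν))⁻¹)⁻¹ : (Matrix.specialUnitaryGroup (Fin 2) ℂ)) : Matrix (Fin 2) (Fin 2) ℂ) +
              vecQuat ((((V (Site.shift (e.1 - Pi.single ν 1) e.2, ν))⁻¹ * (V (e.1 - Pi.single ν 1, e.2))⁻¹ *
                V (e.1 - Pi.single ν 1, ν))⁻¹ : (Matrix.specialUnitaryGroup (Fin 2) ℂ)) : Matrix (Fin 2) (Fin 2) ℂ)))) =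
        fun V : GaugeConfig d L (Matrix.specialUnitaryGroup (Fin 2) ℂ) => vecQuat ((((V e : (Matrix.specialUnitaryGroup (Fin 2) ℂ)) : Matrix (Fin 2) (Fin 2) ℂ))ᴴ * quatVec (∑ ν ∈ Finset.univ.erase e.2,
            (vecQuat (((V (Site.shift e.1 e.2, ν) * (V (Site.shift e.1 ν, e.2))⁻¹ * (V (e.1, ν))⁻¹)⁻¹ : (Matrix.specialUnitaryGroup (Fin 2) ℂ)) : Matrix (Fin 2) (Fin 2) ℂ) +
              vecQuat ((((V (Site.shift (e.1 - Pi.single ν 1) e.2, ν))⁻¹ * (V (e.1 - Pi.single ν 1, e.2))⁻¹ *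
                V (e.1 - Pi.single ν 1, ν))⁻¹ : (Matrix.specialUnitaryGroup (Fin 2) ℂ)) : Matrix (Fin 2) (Fin 2) ℂ)))) :=
      funext fun V => by rw [lmulIso_apply, WilsonFlow.coe_inv_SU]
    rw [heq]
    exact continuous_vecQuat.comp (((continuous_subtype_val.comp (continuous_apply e)).matrix_conjTranspose).mul
      (continuous_quatVec.comp (continuous_stapleJ e)))
  have heq : (fun V : GaugeConfig d L (Matrix.specialUnitaryGroup (Fin 2) ℂ) =>
      (if Real.sin (angle (∑ ν ∈ Finset.univ.erase e.2,
            (vecQuat (((V (Site.shift e.1 e.2, ν) * (V (Site.shift e.1 ν, e.2))⁻¹ * (V (e.1, ν))⁻¹)⁻¹ : (Matrix.specialUnitaryGroup (Fin 2) ℂ)) : Matrix (Fin 2) (Fin 2) ℂ) +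
              vecQuat ((((V (Site.shift (e.1 - Pi.single ν 1) e.2, ν))⁻¹ * (V (e.1 - Pi.single ν 1, e.2))⁻¹ *
                V (e.1 - Pi.single ν 1, ν))⁻¹ : (Matrix.specialUnitaryGroup (Fin 2) ℂ)) : Matrix (Fin 2) (Fin 2) ℂ))) (vecQuat ((V e : (Matrix.specialUnitaryGroup (Fin 2) ℂ)) : Matrix (Fin 2) (Fin 2) ℂ))) = 0 then
            (1 - ε * ‖(∑ ν ∈ Finset.univ.erase e.2,
            (vecQuat (((V (Site.shift e.1 e.2, ν) * (V (Site.shift e.1 ν, e.2))⁻¹ * (V (e.1, ν))⁻¹)⁻¹ : (Matrix.specialUnitaryGroup (Fin 2) ℂ)) : Matrix (Fin 2) (Fin 2) ℂ) +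
              vecQuat ((((V (Site.shift (e.1 - Pi.single ν 1) e.2, ν))⁻¹ * (V (e.1 - Pi.single ν 1, e.2))⁻¹ *
                V (e.1 - Pi.single ν 1, ν))⁻¹ : (Matrix.specialUnitaryGroup (Fin 2) ℂ)) : Matrix (Fin 2) (Fin 2) ℂ)))‖ * Real.cos (angle (∑ ν ∈ Finset.univ.erase e.2,
            (vecQuat (((V (Site.shift e.1 e.2, ν) * (V (Site.shift e.1 ν, e.2))⁻¹ * (V (e.1, ν))⁻¹)⁻¹ : (Matrix.specialUnitaryGroup (Fin 2) ℂ)) : Matrix (Fin 2) (Fin 2) ℂ) +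
              vecQuat ((((V (Site.shift (e.1 - Pi.single ν 1) e.2, ν))⁻¹ * (V (e.1 - Pi.single ν 1, e.2))⁻¹ *
                V (e.1 - Pi.single ν 1, ν))⁻¹ : (Matrix.specialUnitaryGroup (Fin 2) ℂ)) : Matrix (Fin 2) (Fin 2) ℂ))) (vecQuat ((V e : (Matrix.specialUnitaryGroup (Fin 2) ℂ)) : Matrix (Fin 2) (Fin 2) ℂ)))) ^ 3
          else kickJac (ε * ‖(∑ ν ∈ Finset.univ.erase e.2,
            (vecQuat (((V (Site.shift e.1 e.2, ν) * (V (Site.shift e.1 ν, e.2))⁻¹ * (V (e.1, ν))⁻¹)⁻¹ : (Matrix.specialUnitaryGroup (Fin 2) ℂ)) : Matrix (Fin 2) (Fin 2) ℂ) +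
              vecQuat ((((V (Site.shift (e.1 - Pi.single ν 1) e.2, ν))⁻¹ * (V (e.1 - Pi.single ν 1, e.2))⁻¹ *
                V (e.1 - Pi.single ν 1, ν))⁻¹ : (Matrix.specialUnitaryGroup (Fin 2) ℂ)) : Matrix (Fin 2) (Fin 2) ℂ)))‖) 2 (angle (∑ ν ∈ Finset.univ.erase e.2,
            (vecQuat (((V (Site.shift e.1 e.2, ν) * (V (Site.shift e.1 ν, e.2))⁻¹ * (V (e.1, ν))⁻¹)⁻¹ : (Matrix.specialUnitaryGroup (Fin 2) ℂ)) : Matrix (Fin 2) (Fin 2) ℂ) +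
              vecQuat ((((V (Site.shift (e.1 - Pi.single ν 1) e.2, ν))⁻¹ * (V (e.1 - Pi.single ν 1, e.2))⁻¹ *
                V (e.1 - Pi.single ν 1, ν))⁻¹ : (Matrix.specialUnitaryGroup (Fin 2) ℂ)) : Matrix (Fin 2) (Fin 2) ℂ))) (vecQuat ((V e : (Matrix.specialUnitaryGroup (Fin 2) ℂ)) : Matrix (Fin 2) (Fin 2) ℂ))))) =
      fun V : GaugeConfig d L (Matrix.specialUnitaryGroup (Fin 2) ℂ) => (fun j : R4 => (1 - ε * j 0) * (Real.cos (ε * √(dotProduct ![j 1, j 2, j 3] ![j 1, j 2, j 3])) -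
        j 0 * (ε * Real.sinc (ε * √(dotProduct ![j 1, j 2, j 3] ![j 1, j 2, j 3])))) ^ 2)
        (lmulIso (V e)⁻¹ (∑ ν ∈ Finset.univ.erase e.2,
            (vecQuat (((V (Site.shift e.1 e.2, ν) * (V (Site.shift e.1 ν, e.2))⁻¹ * (V (e.1, ν))⁻¹)⁻¹ : (Matrix.specialUnitaryGroup (Fin 2) ℂ)) : Matrix (Fin 2) (Fin 2) ℂ) +
              vecQuat ((((V (Site.shift (e.1 - Pi.single ν 1) e.2, ν))⁻¹ * (V (e.1 - Pi.single ν 1, e.2))⁻¹ *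
                V (e.1 - Pi.single ν 1, ν))⁻¹ : (Matrix.specialUnitaryGroup (Fin 2) ℂ)) : Matrix (Fin 2) (Fin 2) ℂ)))) := by
    funext V
    have h1 := luscherDet_closedForm_eq_booked ε (V e) (∑ ν ∈ Finset.univ.erase e.2,
            (vecQuat (((V (Site.shift e.1 e.2, ν) * (V (Site.shift e.1 ν, e.2))⁻¹ * (V (e.1, ν))⁻¹)⁻¹ : (Matrix.specialUnitaryGroup (Fin 2) ℂ)) : Matrix (Fin 2) (Fin 2) ℂ) +
              vecQuat ((((V (Site.shift (e.1 - Pi.single ν 1) e.2, ν))⁻¹ * (V (e.1 - Pi.single ν 1, e.2))⁻¹ *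
                V (e.1 - Pi.single ν 1, ν))⁻¹ : (Matrix.specialUnitaryGroup (Fin 2) ℂ)) : Matrix (Fin 2) (Fin 2) ℂ)))
    rw [luscherIf_eq_sinc] at h1
    exact h1.symm
  rw [heq]
  exact (continuous_luscherSinc ε).comp hl

/-- The kick of the LO sub-step at a link is continuous in the field (row 7's
`continuous_geodesicKick₂` composed with the continuous staple field and link coordinate). -/
theorem continuous_su2WilsonFlowLOKick (ε : ℝ) (e : Edge d L) :
    Continuous fun V : GaugeConfig d L (Matrix.specialUnitaryGroup (Fin 2) ℂ) => geodesicKick ε (∑ ν ∈ Finset.univ.erase e.2,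
            (vecQuat (((V (Site.shift e.1 e.2, ν) * (V (Site.shift e.1 ν, e.2))⁻¹ * (V (e.1, ν))⁻¹)⁻¹ : (Matrix.specialUnitaryGroup (Fin 2) ℂ)) : Matrix (Fin 2) (Fin 2) ℂ) +
              vecQuat ((((V (Site.shift (e.1 - Pi.single ν 1) e.2, ν))⁻¹ * (V (e.1 - Pi.single ν 1, e.2))⁻¹ *
                V (e.1 - Pi.single ν 1, ν))⁻¹ : (Matrix.specialUnitaryGroup (Fin 2) ℂ)) : Matrix (Fin 2) (Fin 2) ℂ)))
      (vecQuat ((V e : (Matrix.specialUnitaryGroup (Fin 2) ℂ)) : Matrix (Fin 2) (Fin 2) ℂ)) := by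
  have hk := (continuous_geodesicKick₂ (V := R4) ε).comp ((continuous_stapleJ e).prodMk
    (continuous_vecQuat_coe.comp (continuous_apply e)))
  exact hk

/-- The kick of a unit quaternion has unit norm, so it avoids the origin. -/
theorem su2WilsonFlowLOKick_mem_compl (ε : ℝ) (e : Edge d L) (V : GaugeConfig d L (Matrix.specialUnitaryGroup (Fin 2) ℂ)) :
    geodesicKick ε (∑ ν ∈ Finset.univ.erase e.2,
            (vecQuat (((V (Site.shift e.1 e.2, ν) * (V (Site.shift e.1 ν, e.2))⁻¹ * (V (e.1, ν))⁻¹)⁻¹ : (Matrix.specialUnitaryGroup (Fin 2) ℂ)) : Matrix (Fin 2) (Fin 2) ℂ) +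
              vecQuat ((((V (Site.shift (e.1 - Pi.single ν 1) e.2, ν))⁻¹ * (V (e.1 - Pi.single ν 1, e.2))⁻¹ *
                V (e.1 - Pi.single ν 1, ν))⁻¹ : (Matrix.specialUnitaryGroup (Fin 2) ℂ)) : Matrix (Fin 2) (Fin 2) ℂ))) (vecQuat ((V e : (Matrix.specialUnitaryGroup (Fin 2) ℂ)) : Matrix (Fin 2) (Fin 2) ℂ)) ∈ ({(0 : R4)}ᶜ : Set R4) := by
  rw [Set.mem_compl_iff, Set.mem_singleton_iff, ← norm_eq_zero,
    norm_geodesicKick ε _ (norm_vecQuat_of_mem (V e))]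
  exact one_ne_zero

/-- The active-link update `V ↦ gaussUnit (kick)` is continuous (`gaussUnit` is continuous off `0`). -/
theorem continuous_su2WilsonFlowLOKickUnit (ε : ℝ) (e : Edge d L) :
    Continuous fun V : GaugeConfig d L (Matrix.specialUnitaryGroup (Fin 2) ℂ) => gaussUnit (geodesicKick ε (∑ ν ∈ Finset.univ.erase e.2,
            (vecQuat (((V (Site.shift e.1 e.2, ν) * (V (Site.shift e.1 ν, e.2))⁻¹ * (V (e.1, ν))⁻¹)⁻¹ : (Matrix.specialUnitaryGroup (Fin 2) ℂ)) : Matrix (Fin 2) (Fin 2) ℂ) +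
              vecQuat ((((V (Site.shift (e.1 - Pi.single ν 1) e.2, ν))⁻¹ * (V (e.1 - Pi.single ν 1, e.2))⁻¹ *
                V (e.1 - Pi.single ν 1, ν))⁻¹ : (Matrix.specialUnitaryGroup (Fin 2) ℂ)) : Matrix (Fin 2) (Fin 2) ℂ)))
      (vecQuat ((V e : (Matrix.specialUnitaryGroup (Fin 2) ℂ)) : Matrix (Fin 2) (Fin 2) ℂ))) := by
  have h := continuousOn_gaussUnit.comp_continuous (continuous_su2WilsonFlowLOKick ε e)
    (su2WilsonFlowLOKick_mem_compl ε e)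
  exact h

variable {X : Type*} [DecidableEq X] (χ : Site d L → X)

/-- **The masked sub-step map is continuous** (active links: the continuous unit kick; frozen
links: coordinate projections). -/
theorem continuous_su2WilsonFlowLOSubstepFun (s : Fin d × X) (ε : ℝ) :
    Continuous (fun (V : GaugeConfig d L (Matrix.specialUnitaryGroup (Fin 2) ℂ)) (e : Edge d L) =>
        if e.2 = s.1 ∧ χ e.1 = s.2 then
          gaussUnit (geodesicKick ε (∑ ν ∈ Finset.univ.erase e.2,
            (vecQuat (((V (Site.shift e.1 e.2, ν) * (V (Site.shift e.1 ν, e.2))⁻¹ * (V (e.1, ν))⁻¹)⁻¹ : (Matrix.specialUnitaryGroup (Fin 2) ℂ)) : Matrix (Fin 2) (Fin 2) ℂ) +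
              vecQuat ((((V (Site.shift (e.1 - Pi.single ν 1) e.2, ν))⁻¹ * (V (e.1 - Pi.single ν 1, e.2))⁻¹ *
                V (e.1 - Pi.single ν 1, ν))⁻¹ : (Matrix.specialUnitaryGroup (Fin 2) ℂ)) : Matrix (Fin 2) (Fin 2) ℂ)))
            (vecQuat ((V e : (Matrix.specialUnitaryGroup (Fin 2) ℂ)) : Matrix (Fin 2) (Fin 2) ℂ)))
        else V e) := by
  refine continuous_pi fun e => ?_
  exact continuous_if_const _ (fun _ => continuous_su2WilsonFlowLOKickUnit ε e) (fun _ => continuous_apply e)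

variable [NeZero L]

/-- **The layer density (product of the booked factors over the active links) is continuous.** -/
theorem continuous_su2WilsonFlowLOJacobian (s : Fin d × X) (ε : ℝ) :
    Continuous (fun V : GaugeConfig d L (Matrix.specialUnitaryGroup (Fin 2) ℂ) => ∏ a : {e : Edge d L // e.2 = s.1 ∧ χ e.1 = s.2},
          (if Real.sin (angle (∑ ν ∈ Finset.univ.erase a.1.2,
            (vecQuat (((V (Site.shift a.1.1 a.1.2, ν) * (V (Site.shift a.1.1 ν, a.1.2))⁻¹ * (V (a.1.1, ν))⁻¹)⁻¹ : (Matrix.specialUnitaryGroup (Fin 2) ℂ)) : Matrix (Fin 2) (Fin 2) ℂ) +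
              vecQuat ((((V (Site.shift (a.1.1 - Pi.single ν 1) a.1.2, ν))⁻¹ * (V (a.1.1 - Pi.single ν 1, a.1.2))⁻¹ *
                V (a.1.1 - Pi.single ν 1, ν))⁻¹ : (Matrix.specialUnitaryGroup (Fin 2) ℂ)) : Matrix (Fin 2) (Fin 2) ℂ))) (vecQuat ((V a.1 : (Matrix.specialUnitaryGroup (Fin 2) ℂ)) : Matrix (Fin 2) (Fin 2) ℂ))) = 0 then
            (1 - ε * ‖(∑ ν ∈ Finset.univ.erase a.1.2,
            (vecQuat (((V (Site.shift a.1.1 a.1.2, ν) * (V (Site.shift a.1.1 ν, a.1.2))⁻¹ * (V (a.1.1, ν))⁻¹)⁻¹ : (Matrix.specialUnitaryGroup (Fin 2) ℂ)) : Matrix (Fin 2) (Fin 2) ℂ) +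
              vecQuat ((((V (Site.shift (a.1.1 - Pi.single ν 1) a.1.2, ν))⁻¹ * (V (a.1.1 - Pi.single ν 1, a.1.2))⁻¹ *
                V (a.1.1 - Pi.single ν 1, ν))⁻¹ : (Matrix.specialUnitaryGroup (Fin 2) ℂ)) : Matrix (Fin 2) (Fin 2) ℂ)))‖ * Real.cos (angle (∑ ν ∈ Finset.univ.erase a.1.2,
            (vecQuat (((V (Site.shift a.1.1 a.1.2, ν) * (V (Site.shift a.1.1 ν, a.1.2))⁻¹ * (V (a.1.1, ν))⁻¹)⁻¹ : (Matrix.specialUnitaryGroup (Fin 2) ℂ)) : Matrix (Fin 2) (Fin 2) ℂ) +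
              vecQuat ((((V (Site.shift (a.1.1 - Pi.single ν 1) a.1.2, ν))⁻¹ * (V (a.1.1 - Pi.single ν 1, a.1.2))⁻¹ *
                V (a.1.1 - Pi.single ν 1, ν))⁻¹ : (Matrix.specialUnitaryGroup (Fin 2) ℂ)) : Matrix (Fin 2) (Fin 2) ℂ))) (vecQuat ((V a.1 : (Matrix.specialUnitaryGroup (Fin 2) ℂ)) : Matrix (Fin 2) (Fin 2) ℂ)))) ^ 3
          else kickJac (ε * ‖(∑ ν ∈ Finset.univ.erase a.1.2,
            (vecQuat (((V (Site.shift a.1.1 a.1.2, ν) * (V (Site.shift a.1.1 ν, a.1.2))⁻¹ * (V (a.1.1, ν))⁻¹)⁻¹ : (Matrix.specialUnitaryGroup (Fin 2) ℂ)) : Matrix (Fin 2) (Fin 2) ℂ) +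
              vecQuat ((((V (Site.shift (a.1.1 - Pi.single ν 1) a.1.2, ν))⁻¹ * (V (a.1.1 - Pi.single ν 1, a.1.2))⁻¹ *
                V (a.1.1 - Pi.single ν 1, ν))⁻¹ : (Matrix.specialUnitaryGroup (Fin 2) ℂ)) : Matrix (Fin 2) (Fin 2) ℂ)))‖) 2 (angle (∑ ν ∈ Finset.univ.erase a.1.2,
            (vecQuat (((V (Site.shift a.1.1 a.1.2, ν) * (V (Site.shift a.1.1 ν, a.1.2))⁻¹ * (V (a.1.1, ν))⁻¹)⁻¹ : (Matrix.specialUnitaryGroup (Fin 2) ℂ)) : Matrix (Fin 2) (Fin 2) ℂ) +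
              vecQuat ((((V (Site.shift (a.1.1 - Pi.single ν 1) a.1.2, ν))⁻¹ * (V (a.1.1 - Pi.single ν 1, a.1.2))⁻¹ *
                V (a.1.1 - Pi.single ν 1, ν))⁻¹ : (Matrix.specialUnitaryGroup (Fin 2) ℂ)) : Matrix (Fin 2) (Fin 2) ℂ))) (vecQuat ((V a.1 : (Matrix.specialUnitaryGroup (Fin 2) ℂ)) : Matrix (Fin 2) (Fin 2) ℂ))))) :=
  continuous_finsetProd _ fun a _ => continuous_su2WilsonFlowLOFactor ε a.1

end Layer

end Summit.Ventures.LatticeQCDFlow.Exactness
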